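import Summits.ResolutionOfSingularities.ResolutionOfSingularities.Theorems.FrobeniusLadderFInjectiveMacaulayficationExceptionalFibreClause
import Mathlib.RingTheory.Jacobson.Ring
import Mathlib.RingTheory.Ideal.Quotient.Operations
import HarnessLib

/-!
# The clause on the fibre `s = 0` from the clause of the CONE off the origin
# (crux `FInjectiveMacaulayfication`, line `graded-engine`, §17 helper H-G4a♮)

Support file for crux stmt-ResolutionOfSingularities-15315 (`FrobeniusLadder.FInjectiveMacaulayfication`), §17 THE FILTERED
ENGINE (CRUX-PLAN w45a v4, planner's `FilteredEngineSig.lean`, proposed stub G4♮ `stub_filteredChartClause`; seat table v4: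
"stub-2 — H-G4a♮ (cone version of exceptionalFibreClause)"). [OURS · L1 W4.5a] — bookkeeping over landed route lemmas; not a statement
of any manuscript; AI-written, weaker than expert review.

In §17 the carrier is the extended Rees algebra `T = ℛ(R)[1/x̄'_v]` of the `w`-order filtration of `R = k[X]/(f)` (`f` arbitrary prime),
a Noetherian DOMAIN of characteristic `p` containing `s = t⁻¹ ≠ 0`, whose fibre `T/(s)` is the localised initial CONE `(k[X]/(f₀))[1/x̄_v]`,
`f₀ = in_w f` (NOT assumed prime or reduced). Since the presentation of `T` is the line's business (H-G2♮), everything here is stated for an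
ABSTRACT `T` with a surjection `π : T → F` of kernel `(s)`:

* `clause_atMaximal_of_fibreSurjection` — `T` Noetherian domain of characteristic `p`, `0 ≠ s ∈ T`, `π : T →+* F` surjective with
  `ker π = (s)`; if `F_𝔪` satisfies the clause (every system of parameters weakly regular, every parameter ideal Frobenius closed) at every
  MAXIMAL ideal `𝔪` of `F`, then `T_Q` is a domain satisfying the clause at every maximal `Q ∋ s` (E1 `OnExceptionalDeform.stub_onExceptionalDeform`
  p136373 + `QuotLocalizationIso` p136400 + first isomorphism theorem; no primality of the fibre is needed);
* `cone_away_clause_atMaximal` — for ANY `g ∈ k[X₁, …, Xₙ]` and `c > 0`: if `k[X]/(g)` satisfies the clause at its maximal ideals missing some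
  variable (`hoff₀`), then `F = (k[X]/(g))[1/x̄_v^c]` satisfies the clause at EVERY maximal ideal (Jacobson correspondence
  `IsLocalization.isMaximal_iff_isMaximal_disjoint`: maximal ideals of `F` are extended from maximal ideals of `k[X]/(g)` missing `x̄_v`);
* `coneFibreClause` — the two combined: the `hclB` input of `FiniteGradedDescent` / `GradedChartClauseAssembly.chartClause_core` for the
  filtered engine, from `hoff₀` alone, for any presentation `π : T ↠ (k[X]/(g))[1/x̄_v^c]` with kernel `(s)`.

## References

* R. Fedder, *F-purity and rational singularity*, Trans. AMS 278 (1983), Thm. 3.4 (1) (deformation). [Fedder1983]; folklore.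
-/

set_option linter.dupNamespace false

noncomputable section

open Literature.AlgebraicGeometry.Resolution

namespace Summit.ResolutionOfSingularities.ResolutionOfSingularities.Theorems.FInjectiveMacaulayfication.ConeFibreClause

/-- **Deformation across a principal fibre, maximal-ideal form.** `T` a Noetherian domain of characteristic `p`, `0 ≠ s ∈ T`,
`π : T →+* F` surjective with kernel `(s)`. If every localisation of `F` at a maximal ideal satisfies the clause, then for every maximal
ideal `Q ∋ s` of `T` the local ring `T_Q` is a domain satisfying the clause (`T_Q/(s) ≅ F_{π(Q)}` and E1). [cite: Fedder1983, Thm. 3.4 (1)];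
folklore. -/
theorem clause_atMaximal_of_fibreSurjection (p : ℕ) [Fact p.Prime] (T : Type) [CommRing T] [IsDomain T] [IsNoetherianRing T]
    [CharP T p] (s : T) (hs : s ≠ 0) (F : Type) [CommRing F] (π : T →+* F) (hπ : Function.Surjective π)
    (hker : RingHom.ker π = Ideal.span {s})
    (hF : ∀ (𝔪 : Ideal F) [𝔪.IsMaximal],
      ∀ d : ℕ, ringKrullDim (Localization.AtPrime 𝔪) = d → ∀ t : Fin d → Localization.AtPrime 𝔪,
        (Ideal.span (Set.range t)).radical.IsMaximal →
          RingTheory.Sequence.IsWeaklyRegular (Localization.AtPrime 𝔪) (List.ofFn t) ∧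
          ∀ y : Localization.AtPrime 𝔪, (∃ e : ℕ, y ^ p ^ e ∈ Ideal.span
            ((fun z : Localization.AtPrime 𝔪 => z ^ p ^ e) ''
              (Ideal.span (Set.range t) : Set (Localization.AtPrime 𝔪)))) → y ∈ Ideal.span (Set.range t))
    (Q : Ideal T) [Q.IsMaximal] (hsQ : s ∈ Q) :
    IsDomain (Localization.AtPrime Q) ∧
      ∀ d : ℕ, ringKrullDim (Localization.AtPrime Q) = d → ∀ t : Fin d → Localization.AtPrime Q,
        (Ideal.span (Set.range t)).radical.IsMaximal →
          RingTheory.Sequence.IsWeaklyRegular (Localization.AtPrime Q) (List.ofFn t) ∧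
          ∀ y : Localization.AtPrime Q, (∃ e : ℕ, y ^ p ^ e ∈ Ideal.span
            ((fun z : Localization.AtPrime Q => z ^ p ^ e) ''
              (Ideal.span (Set.range t) : Set (Localization.AtPrime Q)))) → y ∈ Ideal.span (Set.range t) := by
  refine OnExceptionalDeform.stub_onExceptionalDeform p T s hs Q hsQ ?_
  -- `Q' = Q/(s)`, a maximal ideal of `T/(s)` pulling back to `Q`
  have hkerle : RingHom.ker (Ideal.Quotient.mk (Ideal.span {s})) ≤ Q := by
    rw [Ideal.mk_ker]
    exact (Ideal.span_singleton_le_iff_mem _).mpr hsQ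
  haveI hQ' : (Q.map (Ideal.Quotient.mk (Ideal.span {s}))).IsMaximal :=
    Ideal.IsMaximal.map_of_surjective_of_ker_le Ideal.Quotient.mk_surjective hkerle
  have hQ'c : (Q.map (Ideal.Quotient.mk (Ideal.span {s}))).comap (Ideal.Quotient.mk (Ideal.span {s})) = Q := by
    rw [Ideal.comap_map_of_surjective _ Ideal.Quotient.mk_surjective, ← RingHom.ker_eq_comap_bot]
    exact sup_eq_left.mpr hkerle
  obtain ⟨e₁⟩ := QuotLocalizationIso.stub_quotLocalizationIso T s Q (Q.map (Ideal.Quotient.mk (Ideal.span {s}))) hQ'c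
  -- `T/(s) ≅ F` (first isomorphism theorem)
  obtain ⟨e, -⟩ : ∃ e : (T ⧸ Ideal.span {s}) ≃+* F, True :=
    ⟨(Ideal.quotEquivOfEq hker.symm).trans (RingHom.quotientKerEquivOfSurjective hπ), trivial⟩
  -- the maximal ideal `𝔪` of `F` corresponding to `Q'`
  obtain ⟨𝔪, h𝔪⟩ : ∃ 𝔪 : Ideal F, 𝔪 = (Q.map (Ideal.Quotient.mk (Ideal.span {s}))).comap e.symm := ⟨_, rfl⟩
  haveI : 𝔪.IsMaximal := by rw [h𝔪]; exact Ideal.comap_isMaximal_of_equiv e.symm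
  obtain ⟨e₂⟩ := BlowupFiModelOfCover.nonempty_ringEquiv_localization_of_ringEquiv e
    (Q.map (Ideal.Quotient.mk (Ideal.span {s}))) 𝔪 (fun x => by
      rw [h𝔪, Ideal.mem_comap, RingEquiv.symm_apply_apply])
  refine DegreeZeroDescent.inlineClause_of_ringEquiv p (e₁.trans e₂).symm ?_
  exact hF 𝔪

/-- **The localised cone is good at every closed point.** For ANY `g ∈ k[X₁, …, Xₙ]` (no primality), `c > 0`, and `hoff₀` = the clause
for `k[X]/(g)` at its maximal ideals missing some variable: the clause holds at every maximal ideal of `(k[X]/(g))[1/x̄_v^c]` — its maximal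
ideals contract to maximal ideals of the Jacobson ring `k[X]/(g)` missing `x̄_v` (`IsLocalization.isMaximal_iff_isMaximal_disjoint`), and
the local rings agree. [folklore] -/
theorem cone_away_clause_atMaximal (p : ℕ) [Fact p.Prime] (k : Type) [Field k] [CharP k p] (n : ℕ)
    (g : MvPolynomial (Fin n) k) (v : Fin n) (c : ℕ) (hc : 0 < c)
    (hoff₀ : ∀ (Q : Ideal (MvPolynomial (Fin n) k ⧸ Ideal.span {g})) [Q.IsMaximal],
      (∃ j : Fin n, Ideal.Quotient.mk (Ideal.span {g}) (MvPolynomial.X j) ∉ Q) →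
      ∀ d : ℕ, ringKrullDim (Localization.AtPrime Q) = d → ∀ t : Fin d → Localization.AtPrime Q,
        (Ideal.span (Set.range t)).radical.IsMaximal →
          RingTheory.Sequence.IsWeaklyRegular (Localization.AtPrime Q) (List.ofFn t) ∧
          ∀ y : Localization.AtPrime Q, (∃ e : ℕ, y ^ p ^ e ∈ Ideal.span
            ((fun z : Localization.AtPrime Q => z ^ p ^ e) ''
              (Ideal.span (Set.range t) : Set (Localization.AtPrime Q)))) → y ∈ Ideal.span (Set.range t))
    (𝔪 : Ideal (Localization.Away (Ideal.Quotient.mk (Ideal.span {g}) (MvPolynomial.X v) ^ c))) [𝔪.IsMaximal] :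
    ∀ d : ℕ, ringKrullDim (Localization.AtPrime 𝔪) = d → ∀ t : Fin d → Localization.AtPrime 𝔪,
      (Ideal.span (Set.range t)).radical.IsMaximal →
        RingTheory.Sequence.IsWeaklyRegular (Localization.AtPrime 𝔪) (List.ofFn t) ∧
        ∀ y : Localization.AtPrime 𝔪, (∃ e : ℕ, y ^ p ^ e ∈ Ideal.span
          ((fun z : Localization.AtPrime 𝔪 => z ^ p ^ e) ''
            (Ideal.span (Set.range t) : Set (Localization.AtPrime 𝔪)))) → y ∈ Ideal.span (Set.range t) := by
  haveI : IsJacobsonRing (MvPolynomial (Fin n) k ⧸ Ideal.span {g}) :=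
    isJacobsonRing_of_finiteType (A := k) (B := MvPolynomial (Fin n) k ⧸ Ideal.span {g})
  -- `P = 𝔪 ∩ k[X]/(g)` is maximal and misses `x̄_v`
  have hP := (IsLocalization.isMaximal_iff_isMaximal_disjoint
    (Localization.Away (Ideal.Quotient.mk (Ideal.span {g}) (MvPolynomial.X v) ^ c))
    (Ideal.Quotient.mk (Ideal.span {g}) (MvPolynomial.X v) ^ c) 𝔪).mp inferInstance
  haveI : (𝔪.under (MvPolynomial (Fin n) k ⧸ Ideal.span {g})).IsMaximal := hP.1
  have hv : Ideal.Quotient.mk (Ideal.span {g}) (MvPolynomial.X v) ∉ 𝔪.under (MvPolynomial (Fin n) k ⧸ Ideal.span {g}) :=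
    fun h => hP.2 (Ideal.pow_mem_of_mem _ h c hc)
  have hcl := hoff₀ (𝔪.under (MvPolynomial (Fin n) k ⧸ Ideal.span {g})) ⟨v, hv⟩
  -- transport along `(k[X]/(g))_P ≅ F_𝔪`
  have e : Localization.AtPrime (𝔪.under (MvPolynomial (Fin n) k ⧸ Ideal.span {g})) ≃+* Localization.AtPrime 𝔪 :=
    (IsLocalization.localizationLocalizationAtPrimeIsoLocalization
      (Submonoid.powers (Ideal.Quotient.mk (Ideal.span {g}) (MvPolynomial.X v) ^ c)) 𝔪).toRingEquiv
  refine DegreeZeroDescent.inlineClause_of_ringEquiv p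
    (L := Localization.AtPrime (𝔪.under (MvPolynomial (Fin n) k ⧸ Ideal.span {g})))
    (L' := Localization.AtPrime 𝔪) e ?_
  exact hcl

/-- **H-G4a♮ `coneFibreClause`.** `T` a Noetherian domain of characteristic `p` (in the filtered engine: the extended Rees algebra chart
`ℛ(R)[1/x̄'_v]`), `0 ≠ s ∈ T`, and a surjection `π : T →+* (k[X]/(g))[1/x̄_v^c]` with kernel `(s)` onto the localised CONE (`g = in_w f`,
any polynomial; `c > 0`). If the cone `k[X]/(g)` satisfies the clause at its maximal ideals missing some variable (`hoff₀`), then at every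
maximal ideal `Q ∋ s` of `T` the local ring `T_Q` is a domain satisfying the clause — the `hclB` input of the descent for the filtered engine.
[cite: Fedder1983, Thm. 3.4 (1)]; folklore. -/
theorem coneFibreClause (p : ℕ) [Fact p.Prime] (k : Type) [Field k] [CharP k p] (n : ℕ)
    (g : MvPolynomial (Fin n) k) (v : Fin n) (c : ℕ) (hc : 0 < c)
    (hoff₀ : ∀ (Q : Ideal (MvPolynomial (Fin n) k ⧸ Ideal.span {g})) [Q.IsMaximal],
      (∃ j : Fin n, Ideal.Quotient.mk (Ideal.span {g}) (MvPolynomial.X j) ∉ Q) →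
      ∀ d : ℕ, ringKrullDim (Localization.AtPrime Q) = d → ∀ t : Fin d → Localization.AtPrime Q,
        (Ideal.span (Set.range t)).radical.IsMaximal →
          RingTheory.Sequence.IsWeaklyRegular (Localization.AtPrime Q) (List.ofFn t) ∧
          ∀ y : Localization.AtPrime Q, (∃ e : ℕ, y ^ p ^ e ∈ Ideal.span
            ((fun z : Localization.AtPrime Q => z ^ p ^ e) ''
              (Ideal.span (Set.range t) : Set (Localization.AtPrime Q)))) → y ∈ Ideal.span (Set.range t))
    (T : Type) [CommRing T] [IsDomain T] [IsNoetherianRing T] [CharP T p] (s : T) (hs : s ≠ 0)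
    (π : T →+* Localization.Away (Ideal.Quotient.mk (Ideal.span {g}) (MvPolynomial.X v) ^ c))
    (hπ : Function.Surjective π) (hker : RingHom.ker π = Ideal.span {s})
    (Q : Ideal T) [Q.IsMaximal] (hsQ : s ∈ Q) :
    IsDomain (Localization.AtPrime Q) ∧
      ∀ d : ℕ, ringKrullDim (Localization.AtPrime Q) = d → ∀ t : Fin d → Localization.AtPrime Q,
        (Ideal.span (Set.range t)).radical.IsMaximal →
          RingTheory.Sequence.IsWeaklyRegular (Localization.AtPrime Q) (List.ofFn t) ∧
          ∀ y : Localization.AtPrime Q, (∃ e : ℕ, y ^ p ^ e ∈ Ideal.span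
            ((fun z : Localization.AtPrime Q => z ^ p ^ e) ''
              (Ideal.span (Set.range t) : Set (Localization.AtPrime Q)))) → y ∈ Ideal.span (Set.range t) :=
  clause_atMaximal_of_fibreSurjection p T s hs _ π hπ hker
    (fun 𝔪 _ => cone_away_clause_atMaximal p k n g v c hc hoff₀ 𝔪) Q hsQ

end Summit.ResolutionOfSingularities.ResolutionOfSingularities.Theorems.FInjectiveMacaulayfication.ConeFibreClause

end
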